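import Summits.QuantumFields.YangMills.Theorems.BalabanUVNodesN19LedgerLinkSync
import Summits.QuantumFields.YangMills.Theorems.BalabanUVNodesN19SizeWindow
import Summits.QuantumFields.YangMills.Theorems.BalabanUVNodesN14SizeBinder

/-!
# BalabanUVNodes ∕ N19 — the ONE-RUN SIZE binder (S) of the term-wise road DERIVED BY NAME: vacuum slices from
# [III] Theorem 2 (2.43) AS PRINTED (`B14.Thm2Printed`, both runs of ONE printed family), dressed slices from node N14's
# pinned pair (`YMDAG.N14.sizeBinder_dressed_of_n14_pinned`), joined to ONE (2.43)-window profile; knit v5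
# (seat dag-n19-a gen 3; Track A node N19, cluster K5 «SpineMatching»; count-neutral)

HONEST FRAMING.  NE7 (two-run matching modulo constants with a summable remainder; `Spine.NE7.Core`) is NOT PRINTED and
NOT proved.  The gen-2 knit chain of this seat (`N19CentreSync` p411746 → `N19ConstantsWindow` p412281 →
`N19ConstantsWindowU2Output` p412947 → `N19OtherKindsU5b` p413531; ledger predicate `N19LedgerLinkSync.LedgerAtSync`
p414645) reduces the N19 edge «in-edges ⇒ `∃ δ, Core … δ ∧ Summable δ`» to the in-edge statements of record BY NAME (N16 ·
N17 · N18 · N22 + the tree row U5b) plus FORMAT∕BOOKING binders (cell NODE O) plus ONE binder pair so far carried as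
«printed-grade»: the zero-centred ONE-RUN SIZE (S) — fields `size` ∕ `sizeProfile` (+ the letter signs `E₀_nonneg a_pos
a_lt_one`) of `LedgerAtSync`: per good term, field point and creation-scale slice `j ≤ K`,
`|Σ_{X ∈ fac K t τ, scale X = j} ((E^B(u_B;X) − E^B(1;X)) − (E^A(u_A;X) − E^A(1;X)))| ≤ S K t τ j ≤ vol·(E₀·(K+1)^m·a^{K−j})`,
`0 < a < 1`.  THIS FILE DERIVES THAT PAIR BY NAME and re-knits:

* the VACUUM slices from [Balaban1988Convergent] Theorem 2 (2.43) p. 263 AS PRINTED — the hypothesis SHAPE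
  `B14.Thm2Printed H033 fam L β κ₀` over ONE printed family of runs containing BOTH runs (the DAG's N11 paper [III];
  the N11 leaf `densitiesDescribed` is Theorem 1, under whose assumptions Theorem 2 is stated) — through dag-n19-b's
  `N19SizeWindow.sizeBinder_of_thm2Printed` (p409886: on the recent log window the printed right side is
  `vol·(E·(k+1)^M·a₁^{k−j′})`, `a₁ = L^{−β}`, ONE `E` for the family): run A's slice at `(j, K)` is dominated by a printed
  E-term at `(j′, k′)` with `k′ − j′ = K − j`, run B's likewise (synchronised booking: `(j+1, K+1)` up to the run offset),
  `k′ ≤ K + K₁` for ONE offset `K₁` (the runs have `K₀ + K`, `K₀ + K + 1` steps), the polynomial weight re-based by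
  `(k′+1)^M ≤ ((K₁+1)(K+1))^M` (§1);
* the DRESSED slices from node N14's pinned pair «`DressedStabilityStrict 𝒯 Λ` ∧ positional counts `N₀Λ₀^{k−j}`,
  `Λ₀ ≤ Λ`» through dag-n14-a's `YMDAG.N14.sizeBinder_dressed_of_n14_pinned` (p416598; K-FREE amplitude `2N₀A₀`, letter
  `ρΛ₀ < 1`), joined to the vacuum profile by `YMDAG.N14.hSle_of_vacuum_add_dressed` — ONE profile
  `vol·((E₁+E₂)·(K+1)^M·a^{K−j})`, `a = max(L^{−β}, ρΛ₀) < 1` (§2, `sizePair_of_n11_n14`, constants BEFORE every ∀);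
* knit v5 `core_summable_of_ledgerAtSync_sizeByName` (§3): the ledger predicate demanded only FOR THE SIZE DATA SO SUPPLIED
  (`hL : ∀ S E₀ m a, size-clauses → LedgerAtSync {L with S, E₀, m, a} …` — i.e. its non-size fields), [III] (2.43) and N14 by
  name, the DISPLAYED identification binders, and the in-edges N16 · N17 · N18 · N22 + (T) exactly as in
  `core_summable_of_ledgerAtSync` ⇒ `∃ δ, NE7.Core l₀ vol T Bad A B δ ∧ Summable δ`.

DISPLAYED IDENTIFICATION BINDERS (instantiated by nobody here — NODE O ∕ the record predicates `SRec`∕`RRec`): (v-A)∕(v-B) each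
vacuum slice's one-run sum at a field point of the good term is dominated by ONE printed E-term `|(fam i).eTerm j′ k′ ω|` of a
family member under Theorem 1's hypotheses (`SatisfiesRG`, `H033`), aligned (`k′ − j′ = K − j`, `1 ≤ j′ ≤ k′ = (fam i).K ≤ K + K₁`),
whose printed large-field volumes `|Γ_n ∩ Ω|` have the recent-log-window profile (nonnegative; `≤ vol` on top; `= 0` below
`jlog(k′)`; `≤ vol·G^{k′−n}` inside) — the BOOKING of the good class, as in `sizeBinder_of_thm2Printed`; LOCATED READING
(census v3): (2.43) is zero-centred for the E-slice NET of `β_j(g_{j−1})A(φ,U_k)`, so `EA`∕`EB` denote the E-functionals net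
of their main-action share (the `β_jA` terms ride the `action` kind, N16's `ActionRate`); (d) the dressed sub-ledger is
identified with births of N14's bookings exactly as in `sizeBinder_dressed_of_n14_pinned` ((ℓ1) aligned injective birth map
felt at `≤ vol` top cubes, (ℓ2) domination by the booked size, (ℓ3) `Λ₀ ≤ Λ`).  One finite four-torus at fixed ε, rung (B)+1;
NOT infinite volume, NOT OS on ℝ⁴, NOT a mass gap, NOT Clay.  Nothing of Bałaban's is asserted or instantiated; N19 is NOT
discharged (no carriers of record); count-neutral.  THEOREMS ONLY; 0 sorry; standard axioms.

CITATION HEADER (LOCATIONS only; statements used ONLY as hypothesis shapes).  [Balaban1988Convergent] Thm 2 (2.43) p. 263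
(`B14.Thm2Printed`, quoted in `BalabanUVNodesN19SizeWindow`); [Balaban1989LargeFieldII] (1.73)–(1.75) pp. 379–380 (N14's
action format, quoted in `Spine/NE1p`); [Balaban1987RG1] (0.26) p. 257.
-/

noncomputable section

open Finset MeasureTheory
open scoped BigOperators

namespace Summit.QuantumFields.YangMills.BalabanUVNodes.N19SizeByName

open Literature.MathematicalPhysics.QuantumFieldTheory.Balaban1983to89
open T4OutputRate T4RecentScale T4GoodClassBudget T4CauchySum T4TowerRateComposition T4TowerRateDischarge
open T4EtaRateMin (Readings NE3Shape)
open T4RateLiaison (GaugeDominated)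
open Summit.QuantumFields.BalabanUV.T4Continuum.Spine
open Summit.QuantumFields.BalabanUV.T4Continuum.NE1p.DressedRoot (DressedTower DressedStabilityStrict)
open Summit.QuantumFields.YangMills.BalabanUVNodes.N19LedgerLinkSync (LedgerDataSync LedgerAtSync
  core_summable_of_ledgerAtSync)
open Summit.QuantumFields.YangMills.BalabanUVNodes.N19SizeWindow (sizeBinder_of_thm2Printed)

/-! ## §1 Arithmetic glue [folklore] -/

/-- A slice's two-run discrepancy is at most the sum of the two runs' one-run slice sizes:
`|Σ_s (e_B − e_A)| ≤ |Σ_s e_B| + |Σ_s e_A|`. [folklore] -/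
theorem abs_sum_sub_le_add {D : Type*} (s : Finset D) (eA eB : D → ℝ) :
    |∑ X ∈ s, (eB X - eA X)| ≤ |∑ X ∈ s, eB X| + |∑ X ∈ s, eA X| := by
  rw [sum_sub_distrib]
  exact abs_sub _ _

/-- Re-basing the polynomial weight of a run with at most `K₁` more steps: `k′ ≤ K + K₁` gives
`(k′+1)^M ≤ ((K₁+1)·(K+1))^M`. [folklore] -/
theorem pow_succ_le_of_offset {k' K K₁ : ℕ} (h : k' ≤ K + K₁) (M : ℕ) :
    ((k' : ℝ) + 1) ^ M ≤ ((((K₁ : ℝ) + 1) * ((K : ℝ) + 1))) ^ M := by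
  refine pow_le_pow_left₀ (by positivity) ?_ M
  have h' : (k' : ℝ) ≤ K + K₁ := by exact_mod_cast h
  have hK : (0 : ℝ) ≤ K := Nat.cast_nonneg K
  have hK₁ : (0 : ℝ) ≤ K₁ := Nat.cast_nonneg K₁
  nlinarith

/-- One run's vacuum slice in the (2.43)-window profile of ITS OWN cutoff `k′`, re-based to the ledger's cutoff `K`:
from `|e| ≤ vol·(E·(k′+1)^M·a^{k′−j′})`, `k′ − j′ = K − j`, `k′ ≤ K + K₁` to `|e| ≤ vol·((E·(K₁+1)^M)·(K+1)^M·a^{K−j})`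
(`vol, E, a ≥ 0`). [folklore] -/
theorem run_slice_rebase {e vol E a : ℝ} {k' j' K j K₁ M : ℕ} (hvol : 0 ≤ vol) (hE : 0 ≤ E) (ha : 0 ≤ a)
    (h : |e| ≤ vol * (E * ((k' : ℝ) + 1) ^ M * a ^ (k' - j'))) (hal : k' - j' = K - j) (hoff : k' ≤ K + K₁) :
    |e| ≤ vol * ((E * (((K₁ : ℝ) + 1)) ^ M) * ((K : ℝ) + 1) ^ M * a ^ (K - j)) := by
  rw [hal] at h
  refine h.trans (mul_le_mul_of_nonneg_left ?_ hvol)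
  have hp := pow_succ_le_of_offset hoff M
  rw [mul_pow] at hp
  calc E * ((k' : ℝ) + 1) ^ M * a ^ (K - j) ≤ E * ((((K₁ : ℝ) + 1)) ^ M * ((K : ℝ) + 1) ^ M) * a ^ (K - j) :=
        mul_le_mul_of_nonneg_right (mul_le_mul_of_nonneg_left hp hE) (pow_nonneg ha _)
    _ = E * (((K₁ : ℝ) + 1)) ^ M * ((K : ℝ) + 1) ^ M * a ^ (K - j) := by ring

/-! ## §2 The (S) pair BY NAME on an abstract slice family: [III] (2.43) (vacuum, both runs) ⊕ N14 (dressed) -/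

section Face

variable {J : Type*} {D : Type}

/-- **THE ONE-RUN SIZE PAIR (S) BY NAME** [bookkeeping].  Data: a slice family indexed by `π : J` under a guard `adm`
(on N19's road `π = (K, t, τ, v)`, `adm` = «`|t| ≤ l₀`, `τ` good, `v` an admissible field point»): ledgers `wf π ⊆ D` with
scales `sc`, the two runs' one-run entries `e_A π`, `e_B π : D → ℝ`, the cutoff `Kof π`, and a decidable mark `dressed` on `D`.
Inputs BY NAME: [III] Thm 2 (2.43) AS PRINTED `B14.Thm2Printed H033 fam L β κ₀` (`0 < β < 1 < L`), node N14's pinned pair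
`DressedStabilityStrict 𝒯 Λ ∧ PositionalCount (N₀Λ₀^{k−j})` (`0 ≤ Λ₀ ≤ Λ`, `N₀ ≥ 0`); letters `vol ≥ 0`, `G ≥ 1`, `Cl ≥ 0`,
an offset `K₁`.  DISPLAYED identification binders: (v-A)∕(v-B) every admissible vacuum slice (`¬ dressed`, scale `j ≤ Kof π`)
of run A ∕ run B is dominated by ONE printed E-term `|(fam i).eTerm j′ (fam i).K ω|` of a member under Thm 1's hypotheses,
aligned `(fam i).K − j′ = Kof π − j`, `1 ≤ j′`, `(fam i).K ≤ Kof π + K₁`, with the recent-log-window profile of the printed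
volumes at `ω`; (d) the dressed sub-ledger is identified with N14's bookings as in `YMDAG.N14.sizeBinder_dressed_of_n14_pinned`.
CONCLUSION: constants `E₀ ≥ 0`, `0 < a < 1`, `m` — chosen BEFORE every `π` — with
`|Σ_{X ∈ wf π, sc X = j}(e_B π X − e_A π X)| ≤ vol·(E₀·(Kof π + 1)^m·a^{Kof π − j})` for every admissible `π` and `j ≤ Kof π`:
N19's `hS` ∧ `hSle` with `S :=` the right side.  Witness: `m = ⌈Cl·log(G∕L^{−β})⌉+1`, `a = max(L^{−β}, ρΛ₀)`,
`E₀ = 2E(K₁+1)^m + 2N₀A₀`.  Nothing instantiated; NOT NE7. [folklore] -/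
theorem sizePair_of_n11_n14 (adm : J → Prop) (wf : J → Finset D) (sc : D → ℕ) (eA eB : J → D → ℝ) (Kof : J → ℕ)
    (dressed : D → Prop) [DecidablePred dressed]
    -- [III] Theorem 2 (2.43) AS PRINTED, one family containing both runs
    (H033 : Flow → ℕ → Prop) {I : Type} (fam : I → B14.Sect2Data) {Lb β : ℝ} {κ₀ : ℕ}
    (h11 : B14.Thm2Printed H033 fam Lb β κ₀) (hβ1 : β < 1) (hβ0 : 0 < β) (hLb : 1 < Lb)
    {vol G Cl : ℝ} (hvol : 0 ≤ vol) (hG : 1 ≤ G) (hCl : 0 ≤ Cl) (K₁ : ℕ)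
    -- node N14, the pinned pair
    {P : Type*} {𝒯 : DressedTower P} {Λ Λ₀ N₀ : ℝ}
    (h14 : DressedStabilityStrict 𝒯 Λ ∧ ∀ p K, (𝒯.B p K).PositionalCount fun j k => N₀ * Λ₀ ^ (k - j))
    (hN₀ : 0 ≤ N₀) (hΛ₀ : 0 ≤ Λ₀) (hle : Λ₀ ≤ Λ)
    -- (v-A) identification, run A's vacuum slices
    (hidA : ∀ π, adm π → ∀ j, j ≤ Kof π → ∃ (i : I) (ω : (fam i).Ω) (j' : ℕ),
      (fam i).flow.SatisfiesRG (fam i).K ∧ H033 (fam i).flow (fam i).K ∧ 1 ≤ j' ∧ j' ≤ (fam i).K ∧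
      (fam i).K - j' = Kof π - j ∧ (fam i).K ≤ Kof π + K₁ ∧
      (∀ n, 0 ≤ (fam i).gammaVol n ω) ∧ (fam i).gammaVol (fam i).K ω ≤ vol ∧
      (∀ n, n < (fam i).K → n < jlogOf Cl (fam i).K → (fam i).gammaVol n ω = 0) ∧
      (∀ n, n < (fam i).K → jlogOf Cl (fam i).K ≤ n → (fam i).gammaVol n ω ≤ vol * G ^ ((fam i).K - n)) ∧
      |∑ X ∈ (wf π).filter (fun X => ¬ dressed X) with sc X = j, eA π X| ≤ |(fam i).eTerm j' (fam i).K ω|)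
    -- (v-B) identification, run B's vacuum slices
    (hidB : ∀ π, adm π → ∀ j, j ≤ Kof π → ∃ (i : I) (ω : (fam i).Ω) (j' : ℕ),
      (fam i).flow.SatisfiesRG (fam i).K ∧ H033 (fam i).flow (fam i).K ∧ 1 ≤ j' ∧ j' ≤ (fam i).K ∧
      (fam i).K - j' = Kof π - j ∧ (fam i).K ≤ Kof π + K₁ ∧
      (∀ n, 0 ≤ (fam i).gammaVol n ω) ∧ (fam i).gammaVol (fam i).K ω ≤ vol ∧
      (∀ n, n < (fam i).K → n < jlogOf Cl (fam i).K → (fam i).gammaVol n ω = 0) ∧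
      (∀ n, n < (fam i).K → jlogOf Cl (fam i).K ≤ n → (fam i).gammaVol n ω ≤ vol * G ^ ((fam i).K - n)) ∧
      |∑ X ∈ (wf π).filter (fun X => ¬ dressed X) with sc X = j, eB π X| ≤ |(fam i).eTerm j' (fam i).K ω|)
    -- (d) identification, the dressed sub-ledger ↔ N14's bookings
    (hidD : ∀ π, adm π → ∃ (pA : P) (βA : D → (𝒯.B pA (Kof π)).Birth) (Q : Finset (𝒯.B pA (Kof π)).Cube)
        (pB : P) (KB : ℕ) (βB : D → (𝒯.B pB KB).Birth),
      (∀ X ∈ (wf π).filter (fun X => dressed X), (𝒯.B pA (Kof π)).birthScale (βA X) = sc X) ∧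
      (∀ j, Set.InjOn βA ↑(((wf π).filter (fun X => dressed X)).filter fun X => sc X = j)) ∧
      (∀ q ∈ Q, (𝒯.B pA (Kof π)).cubeScale q = Kof π) ∧ ((Q.card : ℝ) ≤ vol) ∧
      (∀ X ∈ (wf π).filter (fun X => dressed X), ∃ q ∈ Q, βA X ∈ (𝒯.B pA (Kof π)).feltAt q) ∧
      (∀ X ∈ (wf π).filter (fun X => dressed X), KB - (𝒯.B pB KB).birthScale (βB X) = Kof π - sc X) ∧
      (∀ X ∈ (wf π).filter (fun X => dressed X), |eA π X| ≤ (𝒯.B pA (Kof π)).size (βA X) (Kof π)) ∧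
      (∀ X ∈ (wf π).filter (fun X => dressed X), |eB π X| ≤ (𝒯.B pB KB).size (βB X) KB)) :
    ∃ (E₀ a : ℝ) (m : ℕ), 0 ≤ E₀ ∧ 0 < a ∧ a < 1 ∧ ∀ π, adm π → ∀ j, j ≤ Kof π →
      |∑ X ∈ wf π with sc X = j, (eB π X - eA π X)| ≤ vol * (E₀ * ((Kof π : ℝ) + 1) ^ m * a ^ (Kof π - j)) := by
  -- the printed constant of (2.43) on the window, uniform over the family
  obtain ⟨E, hE0, hrun⟩ := sizeBinder_of_thm2Printed H033 fam h11 hβ1 hβ0 hLb hvol hG hCl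
  -- N14's constants
  obtain ⟨A₀, ρ, hA₀, hρ, hρ1, hface⟩ := YMDAG.N14.sizeBinder_dressed_of_n14_pinned h14 hN₀ hΛ₀ hle
  have hL0 : 0 < Lb := one_pos.trans hLb
  set a₁ : ℝ := Lb ^ (-β) with ha₁
  set M : ℕ := ⌈Cl * Real.log (G / a₁)⌉₊ + 1 with hM
  have ha₁0 : 0 < a₁ := Real.rpow_pos_of_pos hL0 _
  have ha₁1 : a₁ < 1 := Real.rpow_lt_one_of_one_lt_of_neg hLb (by linarith)
  have ha₂0 : 0 ≤ ρ * Λ₀ := mul_nonneg hρ hΛ₀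
  set E₁ : ℝ := 2 * (E * (((K₁ : ℝ) + 1)) ^ M) with hE₁
  have hEK : 0 ≤ E * (((K₁ : ℝ) + 1)) ^ M := mul_nonneg hE0 (by positivity)
  have hE₁0 : 0 ≤ E₁ := by rw [hE₁]; positivity
  have hE₂0 : 0 ≤ 2 * N₀ * A₀ := by positivity
  refine ⟨E₁ + 2 * N₀ * A₀, max a₁ (ρ * Λ₀), M, add_nonneg hE₁0 hE₂0, lt_max_of_lt_left ha₁0,
    max_lt ha₁1 hρ1, fun π hπ j hj => ?_⟩
  -- vacuum part: both runs from (2.43)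
  have hvacA : |∑ X ∈ (wf π).filter (fun X => ¬ dressed X) with sc X = j, eA π X|
      ≤ vol * ((E * (((K₁ : ℝ) + 1)) ^ M) * ((Kof π : ℝ) + 1) ^ M * a₁ ^ (Kof π - j)) := by
    obtain ⟨i, ω, j', hrg, h033, hj1, hjK, hal, hoff, hΓ0, hΓK, hΓold, hΓwin, hdom⟩ := hidA π hπ j hj
    exact run_slice_rebase hvol hE0 ha₁0.le
      (hdom.trans (hrun i hrg h033 j' ω hj1 hjK hΓ0 hΓK hΓold hΓwin)) hal hoff
  have hvacB : |∑ X ∈ (wf π).filter (fun X => ¬ dressed X) with sc X = j, eB π X|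
      ≤ vol * ((E * (((K₁ : ℝ) + 1)) ^ M) * ((Kof π : ℝ) + 1) ^ M * a₁ ^ (Kof π - j)) := by
    obtain ⟨i, ω, j', hrg, h033, hj1, hjK, hal, hoff, hΓ0, hΓK, hΓold, hΓwin, hdom⟩ := hidB π hπ j hj
    exact run_slice_rebase hvol hE0 ha₁0.le
      (hdom.trans (hrun i hrg h033 j' ω hj1 hjK hΓ0 hΓK hΓold hΓwin)) hal hoff
  have hvac : |∑ X ∈ (wf π).filter (fun X => ¬ dressed X) with sc X = j, (eB π X - eA π X)|
      ≤ vol * (E₁ * ((Kof π : ℝ) + 1) ^ M * a₁ ^ (Kof π - j)) := by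
    refine (abs_sum_sub_le_add _ _ _).trans ?_
    have := add_le_add hvacB hvacA
    refine this.trans (le_of_eq ?_)
    rw [hE₁]; ring
  -- dressed part: N14
  have hdr : |∑ X ∈ (wf π).filter (fun X => dressed X) with sc X = j, (eB π X - eA π X)|
      ≤ vol * ((2 * N₀ * A₀) * (ρ * Λ₀) ^ (Kof π - j)) := by
    obtain ⟨pA, βA, Q, pB, KB, βB, hsc, hinj, htop, hQ, hfelt, hscB, hdomA, hdomB⟩ := hidD π hπ
    exact hface ((wf π).filter (fun X => dressed X)) sc (eA π) (eB π) vol (Kof π) pA βA Q pB KB βB hsc hinj htop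
      hQ hfelt hscB hdomA hdomB j hj
  -- join
  exact YMDAG.N14.hSle_of_vacuum_add_dressed (wf π) sc (fun X => eB π X - eA π X) dressed hvol hE₁0 hE₂0 ha₁0.le
    ha₂0 (le_max_left _ _) (le_max_right _ _) hvac hdr

end Face

/-! ## §3 Knit v5: the N19 edge with (S) BY NAME — [III] (2.43) · N14 · N16 · N17 · N18 · N22 + (T) + format∕booking -/

section Edge

variable {C : Carriers} [DecidableEq C.Dom] {F : Type*} {ι X : Type} [MeasurableSpace ι] {σ : Type*} [DecidableEq σ]
  {L : LedgerDataSync C F ι σ} {l₀ vol : ℝ} {T : ℕ → Finset σ} {Bad : ℕ → ℝ → Finset σ} {A B : ℕ → ℝ → σ → ℝ}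
  {R : Readings ι X} {W : Set (ℕ → ℝ)} {EA : Functional C C.BgA} {EB : Functional C C.BgB}
  {κ θ₅ C₅ C₉ ω θc Cd γ C₃ θ₃ Pg : ℝ} {q : ℕ} {Λm : ℕ → ℕ → ℝ} {CU : (ℕ → ℝ) → ℕ → ℝ}
  {g : ℕ → ℕ → ℝ} {uA : ℕ → ι → C.BgA} {uB : ℕ → ι → C.BgB}

/-- **KNIT v5 — THE N19 EDGE WITH THE ONE-RUN SIZE BY NAME** [bookkeeping].  Hypotheses: `hL` — the synchronised ledger
predicate `LedgerAtSync` HOLDS FOR WHATEVER SIZE DATA `(S, E₀, m, a)` MEETS THE SIZE CLAUSES (equivalently: its non-size fields —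
term format, reference ledger, booking, other kinds, rate ordering, `one` — hold; cell NODE O); `vol ≥ 0`; [III] Theorem 2
(2.43) AS PRINTED `B14.Thm2Printed H033 fam L β κ₀` (`0 < β < 1 < L`); node N14's pinned pair `DressedStabilityStrict 𝒯 Λ ∧
PositionalCount (N₀Λ₀^{k−j})`, `0 ≤ Λ₀ ≤ Λ`; the DISPLAYED identifications (v-A), (v-B), (d) of §2 in the ledger's letters
(vacuum slices of `fac K t τ` at each admissible field point ↔ printed E-terms of family members with the window profile;
dressed sub-ledger ↔ N14's births); and the in-edges BY NAME exactly as in `N19LedgerLinkSync.core_summable_of_ledgerAtSync`: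
N16 = `NE3Shape R C₃ θ₃` with `GaugeDominated`, N18 = `NE5`, N22 = `NE9 ∧ FadingMemory`, N17 through node U2's output
`InjectedRate Cd 0 θc disc`, (T) `LipBackground` + `PolyLipGrowth`, window memberships.  CONCLUSION:
`∃ δ, Spine.NE7.Core l₀ vol T Bad A B δ ∧ Summable δ`.  PROOF: §2 at `π = (K, t, τ, v)` supplies `S K t τ j :=
vol·(E₀·(K+1)^m·a^{K−j})` meeting `size` (after `log ∘ exp = id`) and `sizeProfile` (`le_rfl`); `hL` at that data is a
`LedgerAtSync`; then `core_summable_of_ledgerAtSync`.  CONDITIONAL on every binder; NOT NE7; N19 NOT discharged. [folklore] -/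
theorem core_summable_of_ledgerAtSync_sizeByName
    (hL : ∀ (S : ℕ → ℝ → σ → ℕ → ℝ) (E₀ : ℝ) (m : ℕ) (a : ℝ),
      (∀ K t, |t| ≤ l₀ → ∀ τ ∈ T K \ Bad K t, ∀ v ∈ R.dom, ∀ j ≤ K,
        |∑ X ∈ L.fac K t τ with C.scale X = j,
            (Real.log (Real.exp (EB (fun i => g (K + 1) (i + 1)) (uB K v) X
                - EB (fun i => g (K + 1) (i + 1)) L.oneB X))
              - Real.log (Real.exp (EA (g K) (uA K v) X - EA (g K) L.oneA X)))| ≤ S K t τ j) →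
      0 ≤ E₀ → 0 < a → a < 1 →
      (∀ K t, |t| ≤ l₀ → ∀ τ ∈ T K \ Bad K t, ∀ j ≤ K,
        S K t τ j ≤ vol * (E₀ * ((K : ℝ) + 1) ^ m * a ^ (K - j))) →
      LedgerAtSync { L with S := S, E₀ := E₀, m := m, a := a } l₀ vol T Bad A B R EA EB κ g uA uB ω θc θ₅ θ₃)
    (hvol : 0 ≤ vol)
    -- [III] Theorem 2 (2.43) AS PRINTED, one family containing both runs
    (H033 : Flow → ℕ → Prop) {I : Type} (fam : I → B14.Sect2Data) {Lb β : ℝ} {κ₀ : ℕ}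
    (h11 : B14.Thm2Printed H033 fam Lb β κ₀) (hβ1 : β < 1) (hβ0 : 0 < β) (hLb : 1 < Lb)
    {Gv Cl : ℝ} (hGv : 1 ≤ Gv) (hCl : 0 ≤ Cl) (K₁ : ℕ)
    -- node N14, the pinned pair
    {P : Type*} {𝒯 : DressedTower P} {Λ Λ₀ N₀ : ℝ}
    (h14 : DressedStabilityStrict 𝒯 Λ ∧ ∀ p K, (𝒯.B p K).PositionalCount fun j k => N₀ * Λ₀ ^ (k - j))
    (hN₀ : 0 ≤ N₀) (hΛ₀ : 0 ≤ Λ₀) (hle : Λ₀ ≤ Λ)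
    (dressed : C.Dom → Prop) [DecidablePred dressed]
    -- (v-A) run A's vacuum slices ↔ printed E-terms
    (hidA : ∀ K t, |t| ≤ l₀ → ∀ τ ∈ T K \ Bad K t, ∀ v ∈ R.dom, ∀ j ≤ K, ∃ (i : I) (w : (fam i).Ω) (j' : ℕ),
      (fam i).flow.SatisfiesRG (fam i).K ∧ H033 (fam i).flow (fam i).K ∧ 1 ≤ j' ∧ j' ≤ (fam i).K ∧
      (fam i).K - j' = K - j ∧ (fam i).K ≤ K + K₁ ∧
      (∀ n, 0 ≤ (fam i).gammaVol n w) ∧ (fam i).gammaVol (fam i).K w ≤ vol ∧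
      (∀ n, n < (fam i).K → n < jlogOf Cl (fam i).K → (fam i).gammaVol n w = 0) ∧
      (∀ n, n < (fam i).K → jlogOf Cl (fam i).K ≤ n → (fam i).gammaVol n w ≤ vol * Gv ^ ((fam i).K - n)) ∧
      |∑ X ∈ (L.fac K t τ).filter (fun X => ¬ dressed X) with C.scale X = j,
          (EA (g K) (uA K v) X - EA (g K) L.oneA X)| ≤ |(fam i).eTerm j' (fam i).K w|)
    -- (v-B) run B's vacuum slices ↔ printed E-terms
    (hidB : ∀ K t, |t| ≤ l₀ → ∀ τ ∈ T K \ Bad K t, ∀ v ∈ R.dom, ∀ j ≤ K, ∃ (i : I) (w : (fam i).Ω) (j' : ℕ),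
      (fam i).flow.SatisfiesRG (fam i).K ∧ H033 (fam i).flow (fam i).K ∧ 1 ≤ j' ∧ j' ≤ (fam i).K ∧
      (fam i).K - j' = K - j ∧ (fam i).K ≤ K + K₁ ∧
      (∀ n, 0 ≤ (fam i).gammaVol n w) ∧ (fam i).gammaVol (fam i).K w ≤ vol ∧
      (∀ n, n < (fam i).K → n < jlogOf Cl (fam i).K → (fam i).gammaVol n w = 0) ∧
      (∀ n, n < (fam i).K → jlogOf Cl (fam i).K ≤ n → (fam i).gammaVol n w ≤ vol * Gv ^ ((fam i).K - n)) ∧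
      |∑ X ∈ (L.fac K t τ).filter (fun X => ¬ dressed X) with C.scale X = j,
          (EB (fun i => g (K + 1) (i + 1)) (uB K v) X - EB (fun i => g (K + 1) (i + 1)) L.oneB X)|
        ≤ |(fam i).eTerm j' (fam i).K w|)
    -- (d) the dressed sub-ledger ↔ N14's bookings
    (hidD : ∀ K t, |t| ≤ l₀ → ∀ τ ∈ T K \ Bad K t, ∀ v ∈ R.dom,
      ∃ (pA : P) (βA : C.Dom → (𝒯.B pA K).Birth) (Q : Finset (𝒯.B pA K).Cube) (pB : P) (KB : ℕ)
        (βB : C.Dom → (𝒯.B pB KB).Birth),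
      (∀ X ∈ (L.fac K t τ).filter (fun X => dressed X), (𝒯.B pA K).birthScale (βA X) = C.scale X) ∧
      (∀ j, Set.InjOn βA ↑(((L.fac K t τ).filter (fun X => dressed X)).filter fun X => C.scale X = j)) ∧
      (∀ c ∈ Q, (𝒯.B pA K).cubeScale c = K) ∧ ((Q.card : ℝ) ≤ vol) ∧
      (∀ X ∈ (L.fac K t τ).filter (fun X => dressed X), ∃ c ∈ Q, βA X ∈ (𝒯.B pA K).feltAt c) ∧
      (∀ X ∈ (L.fac K t τ).filter (fun X => dressed X), KB - (𝒯.B pB KB).birthScale (βB X) = K - C.scale X) ∧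
      (∀ X ∈ (L.fac K t τ).filter (fun X => dressed X),
        |EA (g K) (uA K v) X - EA (g K) L.oneA X| ≤ (𝒯.B pA K).size (βA X) K) ∧
      (∀ X ∈ (L.fac K t τ).filter (fun X => dressed X),
        |EB (fun i => g (K + 1) (i + 1)) (uB K v) X - EB (fun i => g (K + 1) (i + 1)) L.oneB X|
          ≤ (𝒯.B pB KB).size (βB X) KB))
    -- the in-edges BY NAME and the bracket (T), as in `core_summable_of_ledgerAtSync`
    (h16 : NE3Shape R C₃ θ₃) (hC₃ : 0 ≤ C₃) (hgd : GaugeDominated R uA uB)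
    (h18 : NE5 EA EB W κ θ₅ C₅) (hθ₅ : 0 ≤ θ₅) (hC₅ : 0 ≤ C₅)
    (h22 : NE9 EA W κ Λm ∧ T4OutputRate.FadingMemory C₉ ω Λm) (hω : 0 ≤ ω)
    (hinj : InjectedRate Cd 0 θc (fun K j => T4CouplingMatching.disc (g K) (g (K + 1)) j)) (hCd : 0 ≤ Cd)
    (hθc : 0 ≤ θc) (hbox : ∀ K i, i ≤ K → 0 < g K i ∧ g K i ≤ γ)
    (hU : LipBackground EA W κ CU) (hG : PolyLipGrowth CU g Pg q) (hPg : 0 ≤ Pg)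
    (hgA : ∀ K, g K ∈ W) (hgB : ∀ K, (fun i => g (K + 1) (i + 1)) ∈ W) :
    ∃ δ : ℕ → ℝ, NE7.Core l₀ vol T Bad A B δ ∧ Summable δ := by
  obtain ⟨E₀, a, m, hE₀, ha0, ha1, hS⟩ := sizePair_of_n11_n14 (J := ℕ × ℝ × σ × ι) (D := C.Dom)
    (fun π => |π.2.1| ≤ l₀ ∧ π.2.2.1 ∈ T π.1 \ Bad π.1 π.2.1 ∧ π.2.2.2 ∈ R.dom)
    (fun π => L.fac π.1 π.2.1 π.2.2.1) C.scale
    (fun π X => EA (g π.1) (uA π.1 π.2.2.2) X - EA (g π.1) L.oneA X)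
    (fun π X => EB (fun i => g (π.1 + 1) (i + 1)) (uB π.1 π.2.2.2) X - EB (fun i => g (π.1 + 1) (i + 1)) L.oneB X)
    (fun π => π.1) dressed H033 fam h11 hβ1 hβ0 hLb hvol hGv hCl K₁ h14 hN₀ hΛ₀ hle
    (fun π hπ j hj => hidA π.1 π.2.1 hπ.1 π.2.2.1 hπ.2.1 π.2.2.2 hπ.2.2 j hj)
    (fun π hπ j hj => hidB π.1 π.2.1 hπ.1 π.2.2.1 hπ.2.1 π.2.2.2 hπ.2.2 j hj)
    (fun π hπ => hidD π.1 π.2.1 hπ.1 π.2.2.1 hπ.2.1 π.2.2.2 hπ.2.2)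
  have hLA := hL (fun K _ _ j => vol * (E₀ * ((K : ℝ) + 1) ^ m * a ^ (K - j))) E₀ m a ?_ hE₀ ha0 ha1
    (fun K t _ τ _ j _ => le_rfl)
  · exact core_summable_of_ledgerAtSync hLA h16 hC₃ hgd h18 hθ₅ hC₅ h22 hω hinj hCd hθc hbox hU hG hPg hgA hgB
  · intro K t ht τ hτ v hv j hj
    have h := hS (K, t, τ, v) ⟨ht, hτ, hv⟩ j hj
    rw [sum_congr rfl fun X _ => by rw [Real.log_exp, Real.log_exp]]
    exact h

end Edge

end Summit.QuantumFields.YangMills.BalabanUVNodes.N19SizeByName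

end
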